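import Summits.QuantumFields.YangMills.Theorems.BalabanUVNodesN11K1SupportsOmegaTopGaussianDial

/-!
# DAG node N11 ∕ key K1⁹ — CONSEQUENCES OF THE Ω-TOP POSITIVITY (`…N11K1SupportsOmegaTopGaussianDial`): H's switch–dial identity at every Ω-top child OUTRIGHT
# (the v10 𝐒∕𝐓-law clause of the small-field MAIN TERM met by fiat, zero terms, NO hypothesis), the 𝐒-laws and K1⁹'s (B)-face ∕ consequent from the residual-blind remainder and
# the GAUSSIAN-BARE (R-level) support inclusions at the NON-Ω-top children ONLY (count-neutral, LOCATED; FLAG №15 certificate #5, consumer half)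

HEADER — WORK-UNIT METADATA.  Cell `pub-ymgap`, YM-PLAN Track A (HUMAN RULING D-0062), seat `pub-ymgap-dag-n11-d` (g36; N11 [B14], s2), route `BalabanUVNodes`, item K1⁹ =
stmt-QuantumFields-27364 (helper lane, `--kind proof --supports 27364 --as helper`, count-neutral).  [III] = [Balaban1988Convergent], [IV] = [Balaban1989LargeFieldI], [V] =
[Balaban1989LargeFieldII].  Over this seat's `…N11K1SupportsOmegaTopGaussianDial` (g36 K: `refNewSide_pos_of_Omega_univ`, `exists_gaussUnitResidual`), `…N11K1SupportsAtUnitResidual`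
(g35 J: `sect2Slot_congr_weights`, the unit-residual rows, `WtOfRecord₁₃H_ζ_region_eq_one`), `…N11K1ResidualBlindReduction` (g35 I: `exists_revision₁₃_cor3_iff_of_sameR`,
`betaOfRecord₁₃_eq_of_sameR`), `…N11K1BFaceSect2FormBySupports` (g34 H: `target_eq_sect2Slot_of_switch_dial`, `exists_zh_allSteps_sLaw_zeroTerms_of_supports`,
`exists_thm1Printed_datum_by_fiat_of_supports_of_hypotheses`), `…N11NoExpansionDiagonalCoPH` (`sect2Slot_congr_residual`), `…N11TopPairQuadSlotK1Hypotheses` (the `sameR` transports).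

WHAT THIS FILE PROVES (0 `sorry`, 0 `def`, standard axioms).  §1 ★★★ `target_eq_newSide_of_Omega_univ`: next to the Gaussian dial, for ANY function `T ≥ 0` of the new field (`ρ_{k+1}(s′)`,
`𝐓ρ_k(s′)`, anything) and weight data `W′` agreeing with the dial's below generation `k`, with top `ζ`-factor the SWITCH `𝟙{0 < T}` and top A-weights the DIAL `e^{−½c}·w_k`,
`c = 2·log(J⁰∕T)`: `T(V′) = sect2Slot(W′, s′, 0, e, U)(V′)` at EVERY `V′` of every child with `Ω_{k+1}(s′) = 𝕋` — H §1's identity with `hTJ : 0 < T → 0 < J⁰` DISCHARGED by K §2 (and the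
switch set `{0 < T ∧ 0 < J⁰} = {0 < T}`).  §2 ★★ `sect2Slot_gaussDial_eq_gaussBare` (J §2 shape): the dial's reference new side `J⁰_P(s)` IS 11a's `𝐓_{k+1}(s)` with the GAUSSIAN-BARE weights
`⟨1, Σ_{b∈B_j(Λ′ᶜ∩Ω_{j+1}(s))}‖A_j(b)‖², χ_A⟩` at the torus residual — R-LEVEL, a closed term over `toStage13RParams` and `s`.  §3 ★★★ `exists_zh_sLaw_zeroTerms_of_offTop_gaussSupports` (H §2 at
the dial: the 𝐒-laws at step `k+1` from signs, `δ_k > 0`, `0 ≤ ρ_{k+1}` and the Gaussian-bare support inclusions at the children with `Ω_{k+1}(s) ≠ 𝕋` ONLY; rows OUTRIGHT at `θ′`),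
★★★★★ `exists_thm1Printed_datum_by_fiat_of_offTop_gaussSupports` (K1⁹'s (B)-face conjunct `B16.Thm1Printed (datumOfRecord₁₃SepCoPH θ′ h′).C` inside the FULL class, unity MANUFACTURED,
from the off-top supports alone), ★★★★★★ `k1_consequent_of_residualBlind_remainder_of_offTop_gaussSupports` (K1⁹'s CONSEQUENT VERBATIM from: `θ` with the three R-side conjuncts, signs,
`δ_k > 0`, a version `v` with `Cor3_250`, the window, run rows (i)(iv)(C) — all at `θ` — and the Gaussian-bare supports at the NON-Ω-top children; compared with J's ✓p733083 the whole
Ω-top family has LEFT the hypothesis list and the remaining supports are read at the Gaussian dial, where they are not junk-sensitive).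

THE LOCATED SENTENCE, SHARPENED.  K1⁹ v10's consequent ⟸ K0's three R-side conjuncts + signs + `δ_k > 0` + `Cor3_250` at a version + window + run rows (i)(iv)(C) + ONE qualitative
R-level statement per child `s` with `Ω_{k+1}(s) ≠ 𝕋`: «a.e. on the `χ_{k+1}(s)`-support, `0 < ρ_{k+1}(s)(V) → 0 < I^G_P(s)(V)`» — a V-TRANSPORT statement (the child retains old
variables; in the kernel it needs `map avg Haar ∼ Haar` on the restricted block averaging: N03∕N23-type content, not touched here).  On the Ω-top family — the small-field main term and
every new large-fluctuation child — v10's 𝐒∕𝐓-law rows now say NOTHING AT ALL: they are met by fiat, outright, with zero renormalization terms.  The cure of record is unchanged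
(director-ym №292∕№293: C2's `quad` VALUE row + K0b's `ζ0` VALUE row, v11).

HONEST FRAMING.  Count-neutral LOCATED instrument: kernel bookkeeping over accepted declarations; nothing of Bałaban asserted or refuted; the off-top supports, `Cor3_250`, the window and
the run rows are HYPOTHESES, not inhabited — NO K1⁹ witness is produced, K1⁹'s `∃θ` neither advanced nor refuted; no `Stage13HParams` of record constructed or modified (anonymous
structure updates next to an arbitrary `θ`); N11 NOT discharged; K1⁹ NOT closed; no registered stub touched; counts unmoved (typed 28∕28 · discharged 8∕27 = 8∕28 incl. NODE O).  One finite
four-torus programme at fixed `ε = L^{−K}`; NOT ℝ⁴, NOT OS, NOT a mass gap, NOT Clay.  No `sorry`, `axiom`, `def`, `instance`, `notation`.  Sources (SHAPE only): [V] Thm 1 p.355, (0.1)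
pp.355–356; [III] Thm 1 p.262, Cor. 3 (2.50) p.264, (2.17)–(2.18) p.257, (2.20)–(2.23) p.258, (3.4) p.265, (3.16) p.268, (3.21) p.269, (3.23)–(3.25) p.270; [IV] (0.2)–(0.4) pp.176–177.
-/

noncomputable section

open MeasureTheory
open scoped BigOperators Matrix.Norms.L2Operator

namespace Summit.QuantumFields.YangMills.Theorems.BalabanUVNodesN11K1SupportsOffOmegaTopReduction

open Literature.MathematicalPhysics.QuantumFieldTheory.Balaban1983to89 T4Continuum
open Node00 Node00.Tk B14.Eq218Concrete B14.Sect3Decomp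
open B10Eq42TorusConstraint (bondsIn)
open BalabanUVNodesN11TopPairLocalResidual (WtOfRecord₁₃H_ζ_eq_ζ0)
open BalabanUVNodesN11NoExpansionDiagonalCoPH (sect2Slot_congr_residual)
open BalabanUVNodesN11TopPairQuadSlotK1Hypotheses (provisos₁₃SepCoPH_of_sameR slotsNondegenerate₁₃_of_sameR admissible_of_sameR)
open BalabanUVNodesN11K1BFaceSect2FormBySupports (target_eq_sect2Slot_of_switch_dial exists_zh_allSteps_sLaw_zeroTerms_of_supports
  exists_thm1Printed_datum_by_fiat_of_supports_of_hypotheses slotsOfRecord_nonneg_of_provisos₁₃CoPH)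
open BalabanUVNodesN11K1ResidualBlindReduction (exists_revision₁₃_cor3_iff_of_sameR betaOfRecord₁₃_eq_of_sameR)
open BalabanUVNodesN11K1SupportsAtUnitResidual (sect2Slot_congr_weights zhLaws_of_unitResidual zhLocal_of_unitResidual zhUnity_of_unitResidual WtOfRecord₁₃H_ζ_region_eq_one)
open BalabanUVNodesN11K1SupportsOmegaTopGaussianDial (refNewSide_pos_of_Omega_univ exists_gaussUnitResidual)

variable {F : T4Family} {N : ℕ} [NeZero N]

/-! ## §0. Print's sign `δ_k > 0` along an admissible run in a window inside `]0, 1[` -/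

section Delta

/-- **`δ_k = g_k A₁∕(A₀ (log g_k⁻²)^{p₀}) > 0` ALONG AN ADMISSIBLE RUN IN A WINDOW `]0, γ]`, `γ < 1`** (12a's `deltaOfRecord_pos`: `0 < g_k` from the window, `0 < A₁` from the Stage-12 signs,
`0 < A₀` from the Stage-7 signs, `log g_k⁻² > 0` from `g_k < 1`). [cite: Balaban1988Convergent, (3.4) p.265, (2.4) p.255 (bookkeeping)] -/
theorem deltaOfRecord_pos_of_admissible_of_window (θ : Stage13HParams F N) (hA : θ.Admissible F N) {γ : ℝ} (hγ1 : γ < 1) {P : B12.RunParams}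
    (hI : (settingOfRecord₁₃ F N θ.toStage13Params P).flow.InInterval γ P.K) {k : ℕ} (hk : k ≤ P.K) :
    0 < deltaOfRecord θ.ν (gOfRecord₁₃ F N θ.toStage13Params P) k θ.A₁ := by
  have hg0 : 0 < gOfRecord₁₃ F N θ.toStage13Params P k := (hI k hk).1
  have hg1 : gOfRecord₁₃ F N θ.toStage13Params P k < 1 := lt_of_le_of_lt (hI k hk).2 hγ1
  refine deltaOfRecord_pos hg0 hA.1.pos₁₂.2.1 ?_
  unfold p0Profile
  have hsq : gOfRecord₁₃ F N θ.toStage13Params P k ^ 2 < 1 := by nlinarith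
  exact mul_pos hA.1.toStage9.toStage8.1.2.2.2.1 (pow_pos (Real.log_pos ((one_lt_inv₀ (pow_pos hg0 2)).mpr hsq)) _)

end Delta

/-! ## §1. ★★★ H's switch–dial identity at every Ω-top child OUTRIGHT: any target `T ≥ 0` IS the new side of weights next to the dial, at EVERY new field -/

section Target

variable {θg : Stage13HParams F N}
variable (hζ : ∀ p n Ω Λ j Y ω, (θg.Zh p n Ω Λ).ζ0 j Y ω = Set.indicator {(Ω (j + 1))ᶜ} (1 : Set (Site (F.P p.K) 0) → ℝ) Y)
  (hq : ∀ p n Ω Λ j Λ' ω, (θg.Zh p n Ω Λ).quad j Λ' ω = ∑ b ∈ (Set.toFinite (bondsIn j (Λ'ᶜ ∩ Ω (j + 1)))).toFinset, ‖(ω j).2 b‖ ^ 2)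

open BalabanUVNodesN11K1BFaceSect2FormBySupports (target_eq_sect2Slot_of_switch_dial)

include hζ hq in
/-- ★★★ **THE SWITCH–DIAL IDENTITY AT AN Ω-TOP CHILD, NO SUPPORT HYPOTHESIS**: next to the Gaussian dial, for ANY function `T ≥ 0` of the new field (the post-𝐑 density `ρ_{k+1}(s′)`, the
𝐓-image `𝐓ρ_k(s′)`, anything), weight data `W′` agreeing with the dial's below generation `k`, with top `ζ`-factor the SWITCH `𝟙{0 < T(V_{k+1})}` and top A-weights the DIAL `e^{−½c}·w_k`,
`c = 2·log(J⁰∕T)`, give `T(V′) = sect2Slot(W′, s′, 0, e, U)(V′)` AT EVERY `V′` — H §1's identity with its hypothesis `0 < T → 0 < J⁰` discharged by K §2 (`refNewSide_pos_of_Omega_univ`).  So the v10 𝐒∕𝐓-law CLAUSE of every Ω-top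
child — in particular of the small-field MAIN TERM `(𝕋,…,𝕋; 𝕋)` — is met by fiat OUTRIGHT inside K1⁹'s hypothesis class (the weights `W′` obey `ζ ≥ 0`, `0 ≤ χ ≤ 1`; their top `ζ` reads
the new field only: two-scale local).  LOCATED; nothing of Bałaban asserted. [cite: Balaban1988Convergent, Thm 1 p.262, (2.18) p.257, (2.21)–(2.23) p.258, (3.23)–(3.25) p.270 (bookkeeping)] -/
theorem target_eq_newSide_of_Omega_univ (p : B12.RunParams) {k : ℕ} (s' : SeqOfRecord F θg.ν θg.τ9.M (gOfRecord₁₃ F N θg.toStage13Params p) p.K (k + 1))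
    (hΩ : s'.Ω (k + 1) = Set.univ) (hδ : 0 < deltaOfRecord θg.ν (gOfRecord₁₃ F N θg.toStage13Params p) k θg.A₁) (e₁ : ℝ) (W' : TkWeights F N (FluctV N) p.K)
    (T c : GaugeField (F.P p.K) (k + 1) (SU N) → ℝ)
    (hζlt : ∀ j, j < k → W'.ζ j (s'.Ω (j + 1))ᶜ = (WtOfRecord₁₃H F N θg p s').ζ j (s'.Ω (j + 1))ᶜ)
    (hwlt : ∀ j, j < k → ∀ S₁, W'.w j (s'.Λ (j + 1)) ((s'.Λ (j + 1))ᶜ ∩ s'.Ω (j + 1)) S₁ = (WtOfRecord₁₃H F N θg p s').w j (s'.Λ (j + 1)) ((s'.Λ (j + 1))ᶜ ∩ s'.Ω (j + 1)) S₁)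
    (hζk : ∀ ω, W'.ζ k (s'.Ω (k + 1))ᶜ ω = Set.indicator {V | 0 < T V} (1 : GaugeField (F.P p.K) (k + 1) (SU N) → ℝ) (ω (k + 1)).1)
    (hwk : ∀ S₁ ω, W'.w k (s'.Λ (k + 1)) ((s'.Λ (k + 1))ᶜ ∩ s'.Ω (k + 1)) S₁ ω =
      Real.exp (-(1 / 2 : ℝ) * c (ω (k + 1)).1) * (WtOfRecord₁₃H F N θg p s').w k (s'.Λ (k + 1)) ((s'.Λ (k + 1))ᶜ ∩ s'.Ω (k + 1)) S₁ ω)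
    (hc : ∀ V, 0 < T V →
      c V = 2 * Real.log (sect2Slot F N (FluctV N) p.K (settingOfRecord₁₃ F N θg.toStage13Params p) (θg.rzAt p s')
          { WtOfRecord₁₃H F N θg p s' with ζ := fun j Y ω => if j = k then 1 else (WtOfRecord₁₃H F N θg p s').ζ j Y ω } s' Sect2.TermValues.zero e₁
          (UbgOfRecord₁₃CoP F N θg.toStage13Params p (k + 1) s') V / T V))
    (V' : GaugeField (F.P p.K) (k + 1) (SU N)) (h0 : 0 ≤ T V') :
    T V' = sect2Slot F N (FluctV N) p.K (settingOfRecord₁₃ F N θg.toStage13Params p) (θg.rzAt p s') W' s' Sect2.TermValues.zero e₁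
      (UbgOfRecord₁₃CoP F N θg.toStage13Params p (k + 1) s') V' := by
  have hJ : ∀ V, 0 < sect2Slot F N (FluctV N) p.K (settingOfRecord₁₃ F N θg.toStage13Params p) (θg.rzAt p s')
      { WtOfRecord₁₃H F N θg p s' with ζ := fun j Y ω => if j = k then 1 else (WtOfRecord₁₃H F N θg p s').ζ j Y ω } s' Sect2.TermValues.zero e₁
      (UbgOfRecord₁₃CoP F N θg.toStage13Params p (k + 1) s') V := fun V => refNewSide_pos_of_Omega_univ hζ hq p s' hΩ hδ _ _ e₁ _ V
  refine target_eq_sect2Slot_of_switch_dial θg p s' Sect2.TermValues.zero e₁ W' T c hζlt hwlt (fun ω => ?_) hwk (fun V hT _ => hc V hT) V' h0 fun _ => hJ V'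
  rw [hζk ω]
  congr 1
  exact Set.ext fun V => ⟨fun h => ⟨h, hJ V⟩, fun h => h.1⟩

end Target

/-! ## §2. The dial's reference new side IS 11a's `𝐓_{k+1}(s)` with the GAUSSIAN-BARE weights `⟨1, Σ‖A‖², χ_A⟩` (R-level) -/

section GaussBare

variable {θg : Stage13HParams F N}
variable (hζ : ∀ p n Ω Λ j Y ω, (θg.Zh p n Ω Λ).ζ0 j Y ω = Set.indicator {(Ω (j + 1))ᶜ} (1 : Set (Site (F.P p.K) 0) → ℝ) Y)
  (hq : ∀ p n Ω Λ j Λ' ω, (θg.Zh p n Ω Λ).quad j Λ' ω = ∑ b ∈ (Set.toFinite (bondsIn j (Λ'ᶜ ∩ Ω (j + 1)))).toFinset, ‖(ω j).2 b‖ ^ 2)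

include hζ hq in
/-- ★★ **AT THE GAUSSIAN DIAL THE REFERENCE NEW SIDE IS THE GAUSSIAN-BARE NEW SIDE** (every history `s` of length `k+1`, every setting of terms, constant, background): H's `J_P(s)` —
the dial's weights with the top `ζ`-factor set to `1` — equals `I^G_P(s) := sect2Slot … (θ.Rz P.K) ⟨1, Σ_{b∈B_j(Λ′ᶜ∩Ω_{j+1}(s))}‖A_j(b)‖², χ_A⟩ s t E U`: 11a's `𝐓_{k+1}(s)` with unit `ζ`, the
Gaussian of the integrated variables and the record's own `χ_A` on the operand, at the TORUS residual — a function of `θg.toStage13RParams` and `s` ALONE (J §1's congruence +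
`sect2Slot_congr_residual`). [cite: Balaban1988Convergent, (2.18) p.257, (2.20)–(2.23) p.258, (3.23)–(3.25) p.270 (bookkeeping)] -/
theorem sect2Slot_gaussDial_eq_gaussBare (p : B12.RunParams) {k : ℕ} (s : SeqOfRecord F θg.ν θg.τ9.M (gOfRecord₁₃ F N θg.toStage13Params p) p.K (k + 1))
    (t : Sect2.TermValues (F.P p.K) (MatA N) (FluctV N) θg.τ9.M) (E' : ℝ) (U : BgMap F N p.K)
    (V : GaugeField (F.P p.K) (k + 1) (SU N)) :
    sect2Slot F N (FluctV N) p.K (settingOfRecord₁₃ F N θg.toStage13Params p) (θg.rzAt p s)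
        { WtOfRecord₁₃H F N θg p s with ζ := fun j Y ω => if j = k then 1 else (WtOfRecord₁₃H F N θg p s).ζ j Y ω } s t E' U V =
      sect2Slot F N (FluctV N) p.K (settingOfRecord₁₃ F N θg.toStage13Params p) (θg.Rz p.K)
        (⟨fun _ _ _ => 1, fun j Λ' ω => ∑ b ∈ (Set.toFinite (bondsIn j (Λ'ᶜ ∩ s.Ω (j + 1)))).toFinset, ‖(ω j).2 b‖ ^ 2,
          chiAW F N (FluctV N) θg.ν θg.A₁ p (gOfRecord₁₃ F N θg.toStage13Params p)⟩ : TkWeights F N (FluctV N) p.K) s t E' U V := by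
  rw [sect2Slot_congr_residual _ (θg.rzAt p s) (θg.Rz p.K)]
  refine sect2Slot_congr_weights θg.ν θg.τ9.M (gOfRecord₁₃ F N θg.toStage13Params p) p.K s (fun j _ => ?_) (fun j _ S₁ => ?_) _ _ t E' U V
  · funext ω
    show (if j = k then (1 : ℝ) else (WtOfRecord₁₃H F N θg p s).ζ j (s.Ω (j + 1))ᶜ ω) = 1
    split_ifs with h
    · rfl
    · rw [WtOfRecord₁₃H_ζ_region_eq_one hζ p s j]
  · funext ω
    show chiAW F N (FluctV N) θg.ν θg.A₁ p (gOfRecord₁₃ F N θg.toStage13Params p) j ((s.Λ (j + 1))ᶜ ∩ s.Ω (j + 1)) S₁ ω *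
        Real.exp (-(1 / 2 : ℝ) * (θg.Zh p (k + 1) s.Ω s.Λ).quad j (s.Λ (j + 1)) ω) =
      chiAW F N (FluctV N) θg.ν θg.A₁ p (gOfRecord₁₃ F N θg.toStage13Params p) j ((s.Λ (j + 1))ᶜ ∩ s.Ω (j + 1)) S₁ ω *
        Real.exp (-(1 / 2 : ℝ) * ∑ b ∈ (Set.toFinite (bondsIn j ((s.Λ (j + 1))ᶜ ∩ s.Ω (j + 1)))).toFinset, ‖(ω j).2 b‖ ^ 2)
    rw [hq]

end GaussBare

/-! ## §3. K1⁹'s (B)-face and consequent: supports needed at the NON-Ω-top children only (Gaussian-bare, R-level); the Ω-top family is discharged -/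

section Reduction

/-- ★★★ **THE 𝐒-LAWS OF THE RECORD AT STEP `k+1` BY FIAT FROM SUPPORTS AT THE NON-Ω-TOP CHILDREN ONLY** (H §2 at the Gaussian dial): next to every `θ` there is `θ′` with the SAME
`Stage13RParams` data and `Phih`, rows `zhLocal` ∕ `zhLaws` ∕ `ZhUnity` holding OUTRIGHT (no transfer hypothesis: they hold at the dial), such that for every run `p` and step `k`: the signs,
`δ_k > 0`, `0 ≤ ρ_{k+1}` and the Gaussian-bare support inclusions at the children with `Ω_{k+1}(s) ≠ 𝕋` ALONE give `SLaw₁₃CoPH θ′ p (k+1)` — the §2 [III] form (2.18) of `ρ_{k+1}` with ZERO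
renormalization terms.  The Ω-top children contribute no hypothesis (K §2).  LOCATED, count-neutral; nothing of Bałaban asserted. [cite: Balaban1988Convergent, Thm 1 p.262, (2.17)–(2.18) p.257, (2.21)–(2.23) p.258, (3.23)–(3.25) p.270; Balaban1989LargeFieldI, (0.2)–(0.4) pp.176–177] -/
theorem exists_zh_sLaw_zeroTerms_of_offTop_gaussSupports (θ : Stage13HParams F N) (e : B12.RunParams → ℝ) :
    ∃ θ' : Stage13HParams F N, θ'.toStage13RParams = θ.toStage13RParams ∧ θ'.Phih = θ.Phih ∧
      (∀ p n Ω Λ, (θ'.Zh p n Ω Λ).LocalLaws) ∧ (∀ p n Ω Λ, (θ'.Zh p n Ω Λ).Laws) ∧ θ'.ZhUnity ∧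
      ∀ (p : B12.RunParams) (k : ℕ), 0 ≤ θ.s2.lf.E₀ → 0 ≤ θ.s2.lf.B₀ → (∀ j, j ≤ k + 1 → 0 ≤ gOfRecord₁₃ F N θ.toStage13Params p j) →
        0 < deltaOfRecord θ.ν (gOfRecord₁₃ F N θ.toStage13Params p) k θ.A₁ →
        (∀ (s : SeqOfRecord F θ.ν θ.τ9.M (gOfRecord₁₃ F N θ.toStage13Params p) p.K (k + 1)) (V : GaugeField (F.P p.K) (k + 1) (SU N)),
          0 ≤ slotsOfRecord F N θ.ν θ.τ9 (EOfRecord₁₃ F N θ.toStage13Params) (wOfRecord₉ F N θ.toStage9Params) θ.ppSel p (gOfRecord₁₃ F N θ.toStage13Params p) (k + 1) s V) →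
        (∀ s : SeqOfRecord F θ.ν θ.τ9.M (gOfRecord₁₃ F N θ.toStage13Params p) p.K (k + 1), s.Ω (k + 1) ≠ Set.univ →
          ∀ᵐ V ∂fieldMeasure (F.P p.K) (k + 1) (SU N), chiSeqOfRecord F N θ.ν θ.τ9.M (gOfRecord₁₃ F N θ.toStage13Params p) p.K (k + 1) s V ≠ 0 →
            0 < slotsOfRecord F N θ.ν θ.τ9 (EOfRecord₁₃ F N θ.toStage13Params) (wOfRecord₉ F N θ.toStage9Params) θ.ppSel p (gOfRecord₁₃ F N θ.toStage13Params p) (k + 1) s V →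
            0 < sect2Slot F N (FluctV N) p.K (settingOfRecord₁₃ F N θ.toStage13Params p) (θ.Rz p.K)
              (⟨fun _ _ _ => 1, fun j Λ' ω => ∑ b ∈ (Set.toFinite (bondsIn j (Λ'ᶜ ∩ s.Ω (j + 1)))).toFinset, ‖(ω j).2 b‖ ^ 2,
                chiAW F N (FluctV N) θ.ν θ.A₁ p (gOfRecord₁₃ F N θ.toStage13Params p)⟩ : TkWeights F N (FluctV N) p.K)
              s Sect2.TermValues.zero (e p) (UbgOfRecord₁₃CoP F N θ.toStage13Params p (k + 1) s) V) →
        SLaw₁₃CoPH F N θ' p (k + 1) := by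
  let θ₁ : Stage13HParams F N :=
    { θ with Zh := fun p _ Ω _ => ⟨fun j Y _ => Set.indicator {(Ω (j + 1))ᶜ} (1 : Set (Site (F.P p.K) 0) → ℝ) Y,
        fun j Λ' ω => ∑ b ∈ (Set.toFinite (bondsIn j (Λ'ᶜ ∩ Ω (j + 1)))).toFinset, ‖(ω j).2 b‖ ^ 2⟩ }
  have hζ : ∀ p n Ω Λ j Y ω, (θ₁.Zh p n Ω Λ).ζ0 j Y ω = Set.indicator {(Ω (j + 1))ᶜ} (1 : Set (Site (F.P p.K) 0) → ℝ) Y := fun _ _ _ _ _ _ _ => rfl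
  have hq : ∀ p n Ω Λ j Λ' ω, (θ₁.Zh p n Ω Λ).quad j Λ' ω = ∑ b ∈ (Set.toFinite (bondsIn j (Λ'ᶜ ∩ Ω (j + 1)))).toFinset, ‖(ω j).2 b‖ ^ 2 :=
    fun _ _ _ _ _ _ _ => rfl
  obtain ⟨θ', h1', h2', -, -, hloc, hlaws, hun, hsl⟩ := exists_zh_allSteps_sLaw_zeroTerms_of_supports θ₁ e
  refine ⟨θ', h1', h2', hloc (zhLocal_of_unitResidual hζ), hlaws (zhLaws_of_unitResidual hζ), hun (zhUnity_of_unitResidual hζ),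
    fun p k hE₀ hB₀ hg hδ hρ hsupp => hsl p k hE₀ hB₀ hg hρ fun s => ?_⟩
  by_cases hΩ : s.Ω (k + 1) = Set.univ
  · exact Filter.Eventually.of_forall fun V _ _ => refNewSide_pos_of_Omega_univ (𝔸 := MatA N) hζ hq p s hΩ hδ _ _ _ _ V
  · filter_upwards [hsupp s hΩ] with V hV hχ hρ'
    rw [sect2Slot_gaussDial_eq_gaussBare hζ hq p s]
    exact hV hχ hρ'

/-- ★★★★★ **K1⁹'s (B)-FACE CONJUNCT BY FIAT FROM SUPPORTS AT THE NON-Ω-TOP CHILDREN ONLY.**  From ANY `θ` with `Provisos₁₃SepCoPH ∧ SlotsNondegenerate₁₃ ∧ Admissible` (`ZhUnity` NOT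
assumed) and constants `e_P` there is `θ′ h′` IN K1⁹'s FULL hypothesis class with the SAME `Stage13RParams` data such that for every `γ > 0`: the signs `0 ≤ E₀, B₀`, print's sign
`δ_k > 0` along the runs of the `γ`-window (§0: automatic for `γ < 1` at an admissible `θ`) and, along every run `P` of the `γ`-window and every step `k < K`, the GAUSSIAN-BARE support condition AT THE CHILDREN WITH `Ω_{k+1}(s) ≠ 𝕋` ONLY (a.e. on the `χ_{k+1}(s)`-support:
`0 < ρ_{k+1}(s)(V) → 0 < I^G_P(s)(V)`, `I^G_P(s)` = 11a's `𝐓_{k+1}(s)` with weights `⟨1, Σ‖A‖², χ_A⟩` on `e^{A_{k+1}(s;0,e_P)}∘U_{k+1}` at the torus residual — R-LEVEL) give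
`B16.Thm1Printed (datumOfRecord₁₃SepCoPH F N θ′ h′).C`.  The Ω-top children — the small-field main term among them — need NOTHING (K §2).  LOCATED, count-neutral; the off-top supports are
NOT claimed at any `θ`; nothing of Bałaban asserted or refuted. [cite: Balaban1989LargeFieldII, Thm 1 p.355; Balaban1988Convergent, Thm 1 p.262, (2.17)–(2.18) p.257, (2.20)–(2.23) p.258, (3.16) p.268, (3.21) p.269, (3.23)–(3.25) p.270, (3.4) p.265; Balaban1989LargeFieldI, (0.2)–(0.4) pp.176–177] -/
theorem exists_thm1Printed_datum_by_fiat_of_offTop_gaussSupports (θ : Stage13HParams F N) (hP : θ.Provisos₁₃SepCoPH F N)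
    (hS : θ.SlotsNondegenerate₁₃ F N) (hA : θ.Admissible F N) (e : B12.RunParams → ℝ) :
    ∃ (θ' : Stage13HParams F N) (h' : θ'.Provisos₁₃SepCoPH F N), θ'.toStage13RParams = θ.toStage13RParams ∧
      (θ'.ZhUnity ∧ θ'.SlotsNondegenerate₁₃ F N) ∧ θ'.Admissible F N ∧
      ∀ γ : ℝ, 0 < γ → 0 ≤ θ.s2.lf.E₀ → 0 ≤ θ.s2.lf.B₀ →
        (∀ P : B12.RunParams, (settingOfRecord₁₃ F N θ.toStage13Params P).flow.InInterval γ P.K → ∀ k, k < P.K →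
          0 < deltaOfRecord θ.ν (gOfRecord₁₃ F N θ.toStage13Params P) k θ.A₁) →
        (∀ P : B12.RunParams, (settingOfRecord₁₃ F N θ.toStage13Params P).flow.InInterval γ P.K → ∀ k, k < P.K →
          ∀ s : SeqOfRecord F θ.ν θ.τ9.M (gOfRecord₁₃ F N θ.toStage13Params P) P.K (k + 1), s.Ω (k + 1) ≠ Set.univ →
            ∀ᵐ V ∂fieldMeasure (F.P P.K) (k + 1) (SU N), chiSeqOfRecord F N θ.ν θ.τ9.M (gOfRecord₁₃ F N θ.toStage13Params P) P.K (k + 1) s V ≠ 0 →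
              0 < slotsOfRecord F N θ.ν θ.τ9 (EOfRecord₁₃ F N θ.toStage13Params) (wOfRecord₉ F N θ.toStage9Params) θ.ppSel P (gOfRecord₁₃ F N θ.toStage13Params P) (k + 1) s V →
              0 < sect2Slot F N (FluctV N) P.K (settingOfRecord₁₃ F N θ.toStage13Params P) (θ.Rz P.K)
                (⟨fun _ _ _ => 1, fun j Λ' ω => ∑ b ∈ (Set.toFinite (bondsIn j (Λ'ᶜ ∩ s.Ω (j + 1)))).toFinset, ‖(ω j).2 b‖ ^ 2,
                  chiAW F N (FluctV N) θ.ν θ.A₁ P (gOfRecord₁₃ F N θ.toStage13Params P)⟩ : TkWeights F N (FluctV N) P.K)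
                s Sect2.TermValues.zero (e P) (UbgOfRecord₁₃CoP F N θ.toStage13Params P (k + 1) s) V) →
        B16.Thm1Printed (datumOfRecord₁₃SepCoPH F N θ' h').C := by
  -- the Gaussian-dial unit residual next to `θ`
  let θ₁ : Stage13HParams F N :=
    { θ with Zh := fun p _ Ω _ => ⟨fun j Y _ => Set.indicator {(Ω (j + 1))ᶜ} (1 : Set (Site (F.P p.K) 0) → ℝ) Y,
        fun j Λ' ω => ∑ b ∈ (Set.toFinite (bondsIn j (Λ'ᶜ ∩ Ω (j + 1)))).toFinset, ‖(ω j).2 b‖ ^ 2⟩ }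
  have hζ : ∀ p n Ω Λ j Y ω, (θ₁.Zh p n Ω Λ).ζ0 j Y ω = Set.indicator {(Ω (j + 1))ᶜ} (1 : Set (Site (F.P p.K) 0) → ℝ) Y := fun _ _ _ _ _ _ _ => rfl
  have hq : ∀ p n Ω Λ j Λ' ω, (θ₁.Zh p n Ω Λ).quad j Λ' ω = ∑ b ∈ (Set.toFinite (bondsIn j (Λ'ᶜ ∩ Ω (j + 1)))).toFinset, ‖(ω j).2 b‖ ^ 2 :=
    fun _ _ _ _ _ _ _ => rfl
  have h1 : θ₁.toStage13RParams = θ.toStage13RParams := rfl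
  have hP₁ : θ₁.Provisos₁₃SepCoPH F N := provisos₁₃SepCoPH_of_sameR h1 hP (zhLaws_of_unitResidual hζ) (zhLocal_of_unitResidual hζ)
  obtain ⟨θ', h', h1', -, hUS', hA', hthm⟩ := exists_thm1Printed_datum_by_fiat_of_supports_of_hypotheses θ₁ hP₁ (zhUnity_of_unitResidual hζ)
    (slotsNondegenerate₁₃_of_sameR h1 hS) (admissible_of_sameR h1 hA) e
  refine ⟨θ', h', h1'.trans h1, hUS', hA', fun γ hγ hE₀ hB₀ hδ hsupp => hthm γ hγ hE₀ hB₀ fun P hI k hk s => ?_⟩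
  by_cases hΩ : s.Ω (k + 1) = Set.univ
  · exact Filter.Eventually.of_forall fun V _ _ => refNewSide_pos_of_Omega_univ (𝔸 := MatA N) hζ hq P s hΩ (hδ P hI k hk) _ _ _ _ V
  · filter_upwards [hsupp P hI k hk s hΩ] with V hV hχ hρ
    rw [sect2Slot_gaussDial_eq_gaussBare hζ hq P s]
    exact hV hχ hρ

/-- ★★★★★★ **K1⁹'s CONSEQUENT FROM ITS RESIDUAL-BLIND REMAINDER AND THE OFF-TOP GAUSSIAN-BARE SUPPORTS.**  Let `θ` carry the three R-side class conjuncts (`Provisos₁₃SepCoPH`,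
`SlotsNondegenerate₁₃`, `Admissible`; `ZhUnity` NOT needed) and the signs `0 ≤ E₀, B₀`; suppose AT `θ`: a version `v` with `Cor3_250 (datumOfRecord₁₃SepCoPHV θ hP v).C`, the
non-vacuity window, the run rows (i) (iv) (C) of `betaOfRecord₁₃ θ`; and the Gaussian-bare support conditions along some `γ`-window, `γ < 1` (so that `δ_k > 0`, §0), AT THE CHILDREN WITH
`Ω_{k+1}(s) ≠ 𝕋` ONLY.  THEN K1⁹'s
CONSEQUENT HOLDS VERBATIM.  Compared with J's ✓p733083 `k1_consequent_of_residualBlind_remainder_of_bareSupports` the whole Ω-top family — the small-field main term and every new-`R`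
child — has LEFT the hypothesis list (K §2), and the remaining supports are read at the Gaussian dial, where they are not junk-sensitive.  LOCATED, count-neutral: remainder and off-top
supports are HYPOTHESES, not inhabited; no K1⁹ witness; nothing of Bałaban asserted or refuted. [cite: Balaban1989LargeFieldII, Thm 1 + (0.1) pp.355–356; Balaban1988Convergent, Thm 1 p.262, Cor. 3 (2.50) p.264, (2.17)–(2.18) p.257, (2.20)–(2.23) p.258, (3.23)–(3.25) p.270; Balaban1989LargeFieldI, (0.2)–(0.4) pp.176–177] -/
theorem k1_consequent_of_residualBlind_remainder_of_offTop_gaussSupports (θ : Stage13HParams F N) (hP : θ.Provisos₁₃SepCoPH F N)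
    (hS : θ.SlotsNondegenerate₁₃ F N) (hA : θ.Admissible F N) (hE₀ : 0 ≤ θ.s2.lf.E₀) (hB₀ : 0 ≤ θ.s2.lf.B₀) (e : B12.RunParams → ℝ)
    (v : Revision₁₃ F N θ hP) (hcor : B16.Cor3_250 (datumOfRecord₁₃SepCoPHV F N θ hP v).C)
    (hwin : ∃ γ₁ : ℝ, 0 < γ₁ ∧ ∀ γ : ℝ, 0 < γ → γ ≤ γ₁ → ∃ P : B12.RunParams, 1 ≤ P.K ∧ ((datumOfRecord₁₃SepCoPHV F N θ hP v).C P).flow.InInterval γ P.K)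
    (hrows : ∃ (b : ℕ → ℝ) (r γ₀ M : ℝ), 0 < γ₀ ∧
      (∀ (n : ℕ) (gs : ℕ → ℝ), FlowStep.RGEqH n (betaOfRecord₁₃ F N θ.toStage13Params) gs → Step.InInterval γ₀ n gs →
        ∀ k, k ≤ n → |betaOfRecord₁₃ F N θ.toStage13Params k (FlowStep.prefixOf gs k) - b k| ≤ r) ∧
      (∀ (n : ℕ) (gs : ℕ → ℝ), FlowStep.RGEqH n (betaOfRecord₁₃ F N θ.toStage13Params) gs → Step.InInterval γ₀ n gs →
        ∀ k, k ≤ n → -M ≤ ∑ j ∈ Finset.Ico k n, betaOfRecord₁₃ F N θ.toStage13Params j (FlowStep.prefixOf gs j)) ∧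
      ∀ k : ℕ, ContinuousOn (fun x : ℝ => betaOfRecord₁₃ F N θ.toStage13Params k (FlowStep.clampPrefix (betaOfRecord₁₃ F N θ.toStage13Params) γ₀ k x))
        {x : ℝ | 0 < x ∧ x ≤ γ₀ ∧ ∀ j, j ≤ k → 1 / γ₀ ^ 2 ≤ FlowStep.Y (betaOfRecord₁₃ F N θ.toStage13Params) γ₀ j x})
    (hsupp : ∃ γ : ℝ, 0 < γ ∧ γ < 1 ∧ ∀ P : B12.RunParams, (settingOfRecord₁₃ F N θ.toStage13Params P).flow.InInterval γ P.K → ∀ k, k < P.K →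
      ∀ s : SeqOfRecord F θ.ν θ.τ9.M (gOfRecord₁₃ F N θ.toStage13Params P) P.K (k + 1), s.Ω (k + 1) ≠ Set.univ →
        ∀ᵐ V ∂fieldMeasure (F.P P.K) (k + 1) (SU N), chiSeqOfRecord F N θ.ν θ.τ9.M (gOfRecord₁₃ F N θ.toStage13Params P) P.K (k + 1) s V ≠ 0 →
          0 < slotsOfRecord F N θ.ν θ.τ9 (EOfRecord₁₃ F N θ.toStage13Params) (wOfRecord₉ F N θ.toStage9Params) θ.ppSel P (gOfRecord₁₃ F N θ.toStage13Params P) (k + 1) s V →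
          0 < sect2Slot F N (FluctV N) P.K (settingOfRecord₁₃ F N θ.toStage13Params P) (θ.Rz P.K)
            (⟨fun _ _ _ => 1, fun j Λ' ω => ∑ b ∈ (Set.toFinite (bondsIn j (Λ'ᶜ ∩ s.Ω (j + 1)))).toFinset, ‖(ω j).2 b‖ ^ 2,
              chiAW F N (FluctV N) θ.ν θ.A₁ P (gOfRecord₁₃ F N θ.toStage13Params P)⟩ : TkWeights F N (FluctV N) P.K)
            s Sect2.TermValues.zero (e P) (UbgOfRecord₁₃CoP F N θ.toStage13Params P (k + 1) s) V) :
    ∃ (θ' : Stage13HParams F N) (h' : θ'.Provisos₁₃SepCoPH F N) (v' : Revision₁₃ F N θ' h'),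
      (θ'.ZhUnity ∧ θ'.SlotsNondegenerate₁₃ F N) ∧ θ'.Admissible F N ∧ B16.EndStatementBPrinted (datumOfRecord₁₃SepCoPHV F N θ' h' v').C ∧
      (∃ γ₁ : ℝ, 0 < γ₁ ∧ ∀ γ : ℝ, 0 < γ → γ ≤ γ₁ → ∃ P : B12.RunParams, 1 ≤ P.K ∧ ((datumOfRecord₁₃SepCoPHV F N θ' h' v').C P).flow.InInterval γ P.K) ∧
      ∃ (b : ℕ → ℝ) (r γ₀ M : ℝ), 0 < γ₀ ∧
        (∀ (n : ℕ) (gs : ℕ → ℝ), FlowStep.RGEqH n (betaOfRecord₁₃ F N θ'.toStage13Params) gs → Step.InInterval γ₀ n gs →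
          ∀ k, k ≤ n → |betaOfRecord₁₃ F N θ'.toStage13Params k (FlowStep.prefixOf gs k) - b k| ≤ r) ∧
        (∀ (n : ℕ) (gs : ℕ → ℝ), FlowStep.RGEqH n (betaOfRecord₁₃ F N θ'.toStage13Params) gs → Step.InInterval γ₀ n gs →
          ∀ k, k ≤ n → -M ≤ ∑ j ∈ Finset.Ico k n, betaOfRecord₁₃ F N θ'.toStage13Params j (FlowStep.prefixOf gs j)) ∧
        ∀ k : ℕ, ContinuousOn (fun x : ℝ => betaOfRecord₁₃ F N θ'.toStage13Params k (FlowStep.clampPrefix (betaOfRecord₁₃ F N θ'.toStage13Params) γ₀ k x))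
          {x : ℝ | 0 < x ∧ x ≤ γ₀ ∧ ∀ j, j ≤ k → 1 / γ₀ ^ 2 ≤ FlowStep.Y (betaOfRecord₁₃ F N θ'.toStage13Params) γ₀ j x} := by
  obtain ⟨θ', h', h1, hUS', hA', hthm⟩ := exists_thm1Printed_datum_by_fiat_of_offTop_gaussSupports θ hP hS hA e
  obtain ⟨v', -, hcorIff, hflow, hthmIff⟩ := exists_revision₁₃_cor3_iff_of_sameR h1 hP h' v
  obtain ⟨γ, hγ, hγ1, hsup⟩ := hsupp
  refine ⟨θ', h', v', hUS', hA', ⟨hthmIff.2 (hthm γ hγ hE₀ hB₀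
    (fun P hI k hk => deltaOfRecord_pos_of_admissible_of_window θ hA hγ1 hI hk.le) hsup), hcorIff.2 hcor⟩, ?_, ?_⟩
  · obtain ⟨γ₁, hγ₁, hw⟩ := hwin
    refine ⟨γ₁, hγ₁, fun γ' hγ' hle => ?_⟩
    obtain ⟨P, hK, hI⟩ := hw γ' hγ' hle
    exact ⟨P, hK, by rw [hflow P]; exact hI⟩
  · rw [betaOfRecord₁₃_eq_of_sameR h1]
    exact hrows

end Reduction

end Summit.QuantumFields.YangMills.Theorems.BalabanUVNodesN11K1SupportsOffOmegaTopReduction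

end
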